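import Literature.NumberTheory.FaltingsSerre.Paramodular587plus
import Literature.NumberTheory.FaltingsSerre.CriterionProofs
import HarnessLib

/-!
# `A⁺₅₈₇` is paramodular of level `587` away from `587`, from the frozen certificate — criterion discharged

[BPPTVY] = A. Brumer, A. Pacetti, C. Poor, G. Tornaría, J. Voight, D. S. Yuen, *On the paramodularity of
typical abelian surfaces*, Algebra & Number Theory **13**:5 (2019) 1145–1195 [cite: BrumerEtAl2019]
(§7.3, Thm 7.3.1 p. 1191 treats the MINUS pair `(Jac(587.a.587.1), f₅₈₇⁻)` only).  [PY15] = C. Poor,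
D. S. Yuen, *Paramodular cusp forms*, Math. Comp. **84** (2015) 1401–1438 [cite: PoorYuen2015]:
Thm 1.2 (p. 1402), §7 p. 1432 and Table 5 (p. 1433: `dim J₂,₅₈₇ = 18`, `dim S₂²(K(587)) = 20`, two
columns `587`; column `587⁺`: `λ₂ = −1`, `λ₃ = 0`, `λ₄ = −3`, `λ₅ = 0`, `λ₇ = −2`, `λ₉ = −2`); [PSY20] = C. Poor, J. Shurman, D. S. Yuen, *Nonlift weight two
paramodular eigenform constructions*, J. Korean Math. Soc. **57** (2020), no. 2, 507–522
[cite: PoorShurmanYuen2020]: p. 508 ("for N = 587 there is at most one Fricke plus space nonlift dimension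
and at most one Fricke minus space nonlift dimension", summarizing [PY15]), Thm 1.1 (p. 508:
`dim S₂(K(587))⁺ = 19 = 18 + 1`, `dim S₂(K(587))⁻ = 1`) — existence and uniqueness of the plus nonlift
`f₅₈₇⁺` —, Thm 1.2 (p. 509, proof §6 pp. 520–521: "The conjectured nonlift eigenform formulas
`f_N = Q_N/L_N` of [PY15] and its website are correct for `N = 349, 353, 389, 461, 523, 587±`") — the
printed justification of the website formula `QL-587plus.txt` that the certificate's form-side
implementations evaluate — and §5 (pp. 519–520: `S₂(K(587))⁺` contains no nonlift Borcherds product;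
`f₅₈₇⁺` is traced down from a polarized Borcherds product in `S₂(K(1174))⁻`).  The printed [PSY20] is the
"expanded version" announced in arXiv:1805.04137v1, which states Thm 1.1 only.

`Literature.NumberTheory.FaltingsSerre.Paramodular587plus.paramodular_587plus` (p189041, instance of
`ParamodularTemplate.lean` for the frozen certificate `certs/587/plus/certificate.canonical.json`, sha256
`9ac7f5381b505f82e7e8e9323eccada07156e3105b7cfaeb79e03dd40afb02f1`) carries the hypothesis
`hFS : traceEq_of_faltingsSerre_symplectic` (the Faltings–Serre criterion [BPPTVY, Thm. 2.1.5 p. 1150 /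
Alg. 2.4.1 p. 1155] as a named statement).  That statement is PROVED in the tree
(`Literature.NumberTheory.FaltingsSerre.traceEq_of_faltingsSerre_symplectic_holds`, `CriterionProofs.lean`,
p181742), so — exactly as `ParamodularUnconditional.paramodular_277_holds` (N = 277) and
`Paramodular349.paramodular_349_holds` (N = 349) do — this file restates `paramodular_587plus` WITHOUT
`hFS`.  Remaining binders: the certificate `hC` (discharged outside the kernel, every load-bearing datum by
two independent implementations; the Galois half is a certified TRANSFER of the `587⁻` class-field /
obstruction computation along an explicit isomorphism `A⁺[2] ≃ A⁻[2]`; referee ruling S46, REFEREE.md R48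
Audit 77), the `A`-side frame/Euler data, the cited `ρ_{f,2}` of [BPPTVY, Thm. 4.3.4 p. 1169] (`hρf`,
Arthur-dependent via Mok), the form data, and the hand check at `p = 2` (`a₂ = −1`, `b₂ = 3` both sides).

Provenance of the curve (DATA, not a cited theorem): `C⁺ : y² + (x³+x+1)y = −x⁶+4x⁴+x³+2x²−14x+14` is
the curve `587.a2` of the LMFDB table `g2c_curves_new` (Booker–Sutherland small-conductor genus-2
database; alpha release, now also served by beta.lmfdb.org), pulled 2026-08-19T02:21:06Z, file
`pub-paramod-lit/data/alpha_g4/alpha_g2cnew_usp4_le1000.json` of the cell, sha256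
`ffb86085e68d88cea6faa399efc30bacd4b930ef2a20c4baaff5c069d0ba1914`; its conductor `587` and every Euler
factor used were RECOMPUTED twice by the cell (the Euler factor at the almost-good prime `3`,
`L₃(A⁺,T) = 1 + T² + 9T⁴`, by two implementations of the algorithm of Maistret–Sutherland, Res. Number
Theory 11 (2025) [cite: MaistretSutherland2025]).  The existence of a rank-0 surface of conductor 587
besides BPPTVY's rank-1 one is recorded in print ([PY15] p. 1402: "For 587 there are actually two known
isogeny classes").  HONEST FRAMING: the method is [BPPTVY]'s; this level-`587`, sign-`+` pairing is not in
print as of 2026-08-19 (cell FRESHNESS.md §12(e), §15–§16) — a new pair certified by a published method,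
never claimed 'first'.
-/

noncomputable section

namespace Literature.NumberTheory.FaltingsSerre.Paramodular587plus

open Polynomial IsDedekindDomain
open Literature.NumberTheory.FaltingsSerre Literature.NumberTheory.GaloisRepresentations
  Literature.NumberTheory.Automorphic.Paramodular Literature.NumberTheory.Automorphic
  Literature.AlgebraicGeometry.Motives
open scoped NumberField

/-- **`A⁺ = Jac(C⁺)` is paramodular of level `587` away from `587`, with partner `f₅₈₇⁺` — criterion
discharged**: the statement of `paramodular_587plus` without `hFS`, supplied by
`traceEq_of_faltingsSerre_symplectic_holds` ([BPPTVY, Thm. 2.1.5 p. 1150 / Alg. 2.4.1 p. 1155], proved in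
`CriterionProofs.lean`). [cite: BrumerEtAl2019, Thm 2.1.5 p. 1150; Alg 2.4.1 p. 1155; Thm 4.3.4 p. 1169; §7.3 p. 1191 (the minus pair); PoorYuen2015, Table 5 p. 1433; PoorShurmanYuen2020, Thm 1.1 p. 508, Thm 1.2 p. 509] -/
theorem paramodular_587plus_holds
    {A : AbelianVariety ℚ} {f : Matrix (Fin 2) (Fin 2) ℂ → ℂ}
    {ρA ρf : FramedGaloisRep ℚ ℤ_[2] 4} {J : Matrix (Fin 4) (Fin 4) ℤ_[2]}
    {ν : Field.absoluteGaloisGroup ℚ → ℤ_[2]}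
    {b : Module.Basis (Fin 4) ℚ_[2] (A.rationalTateModule 2)}
    (hC : Certificate587plus J ν ρA ρf)
    (hframe : A.IsFrameOfTateRep 2 b (rationalize ρA))
    (aA bA af bf : ℕ → ℤ)
    (hA : ∀ p : ℕ, p.Prime → ¬ p ∣ 587 →
      A.HasGoodEulerFactorAt p ((lPolynomialOfSurface p (aA p) (bA p)).map (Int.castRingHom ℚ)))
    (hρf : ∀ p : ℕ, p.Prime → ¬ p ∣ 587 → p ≠ 2 →
      ∀ v : HeightOneSpectrum (𝓞 ℚ), ((p : ℕ) : 𝓞 ℚ) ∈ v.asIdeal →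
        ρf.HasFrobCharpolyAt v
          ((lPolynomialOfSurface p (af p) (bf p)).reverse.map (Int.castRingHom ℤ_[2])))
    (hcusp : IsParamodularCuspForm 587 2 f) (hne : ∃ Z ∈ siegelUpperHalfSpace 2, f Z ≠ 0)
    (hfe : ∀ p : ℕ, p.Prime → ¬ p ∣ 587 →
      HasSpinorEulerFactorAt 2 p f ((lPolynomialOfSurface p (af p) (bf p)).map (Int.castRingHom ℂ)))
    (h2 : aA 2 = af 2 ∧ bA 2 = bf 2) :
    IsParamodularAwayFrom A 587 f :=
  paramodular_587plus traceEq_of_faltingsSerre_symplectic_holds hC hframe aA bA af bf hA hρf hcusp hne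
    hfe h2

/-- The unconditional conclusion at one prime `p ≠ 587`: one polynomial is both `L_p(A⁺,T)` and
`Q_p(f₅₈₇⁺,T)`. [cite: BrumerEtAl2019, Thm 7.3.1 p. 1191 (shape of the statement, minus pair)] -/
theorem eulerFactors_agree_587plus_holds
    {A : AbelianVariety ℚ} {f : Matrix (Fin 2) (Fin 2) ℂ → ℂ}
    {ρA ρf : FramedGaloisRep ℚ ℤ_[2] 4} {J : Matrix (Fin 4) (Fin 4) ℤ_[2]}
    {ν : Field.absoluteGaloisGroup ℚ → ℤ_[2]}
    {b : Module.Basis (Fin 4) ℚ_[2] (A.rationalTateModule 2)}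
    (hC : Certificate587plus J ν ρA ρf)
    (hframe : A.IsFrameOfTateRep 2 b (rationalize ρA))
    (aA bA af bf : ℕ → ℤ)
    (hA : ∀ p : ℕ, p.Prime → ¬ p ∣ 587 →
      A.HasGoodEulerFactorAt p ((lPolynomialOfSurface p (aA p) (bA p)).map (Int.castRingHom ℚ)))
    (hρf : ∀ p : ℕ, p.Prime → ¬ p ∣ 587 → p ≠ 2 →
      ∀ v : HeightOneSpectrum (𝓞 ℚ), ((p : ℕ) : 𝓞 ℚ) ∈ v.asIdeal →
        ρf.HasFrobCharpolyAt v
          ((lPolynomialOfSurface p (af p) (bf p)).reverse.map (Int.castRingHom ℤ_[2])))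
    (hcusp : IsParamodularCuspForm 587 2 f) (hne : ∃ Z ∈ siegelUpperHalfSpace 2, f Z ≠ 0)
    (hfe : ∀ p : ℕ, p.Prime → ¬ p ∣ 587 →
      HasSpinorEulerFactorAt 2 p f ((lPolynomialOfSurface p (af p) (bf p)).map (Int.castRingHom ℂ)))
    (h2 : aA 2 = af 2 ∧ bA 2 = bf 2) {p : ℕ} (hp : p.Prime) (hpN : p ≠ 587) :
    ∃ Q : Polynomial ℚ, HasSpinorEulerFactorAt 2 p f (Q.map (algebraMap ℚ ℂ)) ∧
      A.HasGoodEulerFactorAt p Q :=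
  eulerFactors_agree_587plus (paramodular_587plus_holds hC hframe aA bA af bf hA hρf hcusp hne hfe h2)
    hp hpN

end Literature.NumberTheory.FaltingsSerre.Paramodular587plus

end
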